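import Summits.Ventures.Crystal3D.Theorems.StickyWulffConstantTextureBuildRiserFrameDefs
import HarnessLib

/-!
# The RISER PACKAGE (B6), part 3: GEOMETRY OF THE HEXAGON PRISMS — vertical walls, horizontal faces, the polytope, the in-plane identity, `dist < 1`
# (lane T, crux `TextureLiminfV5`, stmt-Ventures-23912; design memo HOME/wulff-p2/g21/B6-DESIGN-g21.md §1–§3; target `RiserPackage₇` of '…TextureBuildMeshV7')

HONEST FRAMING. Venture `Summits/Ventures/Crystal3D` (cell `crystal3d-full`), route `route-Ventures-StickyWulffConstant`, helper `--supports` the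
law-v5 crux `TextureLiminfV5` (stmt-Ventures-23912).  Elementary Euclidean geometry of the hexagon prisms `hexPrism` of '…RiserFrameDefs' (census-free, standard
axioms); nothing about contacts or curtains yet; F-C1 not moved.

* `inner_sixDir_e₃`, `inner_hexWall_rn` — hexagon WALLS are VERTICAL (`⟪ν, rn r⟫ = 0`: curtain data); `fst_of_mem_hexPrism` — every prism datum is a wall or has
  normal `± rn r` (a FACE: free by the shared axis, '…RiserAxis');
* `mem_polytope_hexPrism_iff` — `x ∈ polytope (hexPrism r c m)` iff the six wall inequalities `⟪rL ν_t, x − c⟫ < ½` and `govLo < rheight x < govHi`;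
* `inplane_sq_eq` — the tight-frame identity `Σ_{ν ∈ {u,v,v−u}} ⟪rL ν, w⟫² = 3/2·(‖w‖² − ⟪rL e₃, w⟫²)`; `inplane_sq_le_third_of_hexagon` — inside the closed hexagon
  the in-plane part of `w` has `‖·‖² ≤ 1/3` (circumradius `1/√3`; casework `p² − pq + q² ≤ ¼`);
* `govLo_ge`, `govHi_le`; **`dist_lt_one_of_mem_hexPrism`** — a point of `G_c` is within distance `< 1` of the site `c` (so `Mesh₅.hBhalo` / `Mesh₇.hBownRn` apply to `c`).
-/

noncomputable section

open scoped BigOperators InnerProductSpace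

namespace Summit.Ventures.Crystal3D.Cruxes.TextureLiminf.TexShadow

open Summit.Ventures.Crystal3D Summit.Ventures.Crystal3D.Theorems Set
open Summit.Ventures.Crystal3D.TentCertificate (height hB hB_pos hB_sq)
open Literature.MathematicalPhysics.StatisticalMechanics (triangularVec₁ triangularVec₂)

/-! ### The six directions are horizontal -/

/-- `ν₀ = u`. -/
theorem sixDir_zero : sixDir 0 = triangularVec₁ 1 := rfl
/-- `ν₁ = v`. -/
theorem sixDir_one : sixDir 1 = triangularVec₂ 1 := rfl
/-- `ν₂ = v − u`. -/
theorem sixDir_two : sixDir 2 = triangularVec₂ 1 - triangularVec₁ 1 := rfl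
/-- `ν₃ = −u`. -/
theorem sixDir_three : sixDir 3 = -triangularVec₁ 1 := rfl
/-- `ν₄ = −v`. -/
theorem sixDir_four : sixDir 4 = -triangularVec₂ 1 := rfl
/-- `ν₅ = u − v`. -/
theorem sixDir_five : sixDir 5 = triangularVec₁ 1 - triangularVec₂ 1 := rfl

/-- Coordinates of the six directions: third coordinate `0`. -/
theorem sixDir_apply_two (t : Fin 6) : sixDir t 2 = 0 := by
  fin_cases t <;> simp [sixDir, triangularVec₁, triangularVec₂]

/-- The six directions are orthogonal to `e₃`. -/
theorem inner_sixDir_e₃ (t : Fin 6) : ⟪sixDir t, e₃⟫_ℝ = 0 := by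
  rw [e₃, EuclideanSpace.inner_single_right]
  simp [sixDir_apply_two]

/-- Inner products with `u`, `v` and `e₃` in coordinates. -/
private theorem inner_u (w : E3) : ⟪(triangularVec₁ 1 : E3), w⟫_ℝ = w 0 := by
  rw [EuclideanSpace.inner_eq_star_dotProduct]
  simp [dotProduct, Fin.sum_univ_three, triangularVec₁]

/-- `⟪v, w⟫` in coordinates. -/
private theorem inner_v (w : E3) : ⟪(triangularVec₂ 1 : E3), w⟫_ℝ = w 0 / 2 + Real.sqrt 3 / 2 * w 1 := by
  rw [EuclideanSpace.inner_eq_star_dotProduct]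
  simp [dotProduct, Fin.sum_univ_three, triangularVec₂]
  ring

/-- `⟪e₃, w⟫` in coordinates. -/
private theorem inner_e₃' (w : E3) : ⟪e₃, w⟫_ℝ = w 2 := by
  rw [e₃, EuclideanSpace.inner_single_left]; simp

/-- `‖w‖²` in coordinates. -/
private theorem norm_sq_three' (w : E3) : ‖w‖ ^ 2 = w 0 ^ 2 + w 1 ^ 2 + w 2 ^ 2 := by
  rw [EuclideanSpace.norm_sq_eq, Fin.sum_univ_three]
  simp [Real.norm_eq_abs, sq_abs]

namespace Mesh₅

variable {C R₀ : ℝ} {N : ℕ} {x : Fin N → E3} {rc : RiseredCover C R₀ N x} {δ : ℝ} (μ : Mesh₅ rc δ)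

/-- The riser normal is the frame's `e₃`. -/
theorem rn_eq (r : Fin rc.nr) : rc.rn r = μ.rL r e₃ := (μ.rframe_spec r).2.2.2.2

/-- **Hexagon walls are vertical** (curtain data): `⟪(hexWall r c t).1, rn r⟫ = 0`. -/
theorem inner_hexWall_rn (r : Fin rc.nr) (c : E3) (t : Fin 6) : ⟪(μ.hexWall r c t).1, rc.rn r⟫_ℝ = 0 := by
  simp only [hexWall, μ.rn_eq r, LinearIsometryEquiv.inner_map_map, inner_sixDir_e₃]

/-- Membership in the prism data. -/
theorem mem_hexPrism_iff {r : Fin rc.nr} {c : E3} {m : ℤ} {p : E3 × ℝ} :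
    p ∈ μ.hexPrism r c m ↔ (∃ t, p = μ.hexWall r c t) ∨ p = (rc.rn r, μ.govHi r m + ⟪rc.rn r, μ.rs r⟫_ℝ) ∨
      p = (-rc.rn r, -(μ.govLo r m + ⟪rc.rn r, μ.rs r⟫_ℝ)) := by
  simp only [hexPrism, Finset.mem_union, Finset.mem_image, Finset.mem_univ, true_and, Finset.mem_insert, Finset.mem_singleton]
  constructor
  · rintro (⟨t, ht⟩ | h | h)
    · exact Or.inl ⟨t, ht.symm⟩
    · exact Or.inr (Or.inl h)
    · exact Or.inr (Or.inr h)
  · rintro (⟨t, ht⟩ | h | h)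
    · exact Or.inl ⟨t, ht.symm⟩
    · exact Or.inr (Or.inl h)
    · exact Or.inr (Or.inr h)

/-- **Every prism datum is a vertical wall or a horizontal face.** -/
theorem fst_of_mem_hexPrism {r : Fin rc.nr} {c : E3} {m : ℤ} {p : E3 × ℝ} (hp : p ∈ μ.hexPrism r c m) :
    ⟪p.1, rc.rn r⟫_ℝ = 0 ∨ p.1 = rc.rn r ∨ p.1 = -rc.rn r := by
  rcases μ.mem_hexPrism_iff.1 hp with ⟨t, rfl⟩ | rfl | rfl
  · exact Or.inl (μ.inner_hexWall_rn r c t)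
  · exact Or.inr (Or.inl rfl)
  · exact Or.inr (Or.inr rfl)

/-- The riser height is linear: `rheight x = ⟪rn r, x⟫ − ⟪rn r, rs r⟫`. -/
theorem rheight_eq (r : Fin rc.nr) (y : E3) : μ.rheight r y = ⟪rc.rn r, y⟫_ℝ - ⟪rc.rn r, μ.rs r⟫_ℝ := by
  rw [rheight, height_eq_inner, μ.rn_eq r]

/-- **The hexagon prism as a set**: six wall inequalities and the governing height window. -/
theorem mem_polytope_hexPrism_iff (r : Fin rc.nr) (c : E3) (m : ℤ) (y : E3) :
    y ∈ polytope (μ.hexPrism r c m) ↔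
      (∀ t, ⟪μ.rL r (sixDir t), y⟫_ℝ < ⟪μ.rL r (sixDir t), c⟫_ℝ + 1 / 2) ∧ μ.govLo r m < μ.rheight r y ∧ μ.rheight r y < μ.govHi r m := by
  rw [μ.rheight_eq r y]
  simp only [polytope, mem_iInter, mem_setOf_eq]
  constructor
  · intro h
    refine ⟨fun t => h _ (μ.mem_hexPrism_iff.2 (Or.inl ⟨t, rfl⟩)), ?_, ?_⟩
    · have := h _ (μ.mem_hexPrism_iff.2 (Or.inr (Or.inr rfl)))
      simp only [inner_neg_left] at this; linarith
    · have := h _ (μ.mem_hexPrism_iff.2 (Or.inr (Or.inl rfl)))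
      simp only at this; linarith
  · rintro ⟨hw, hlo, hhi⟩ p hp
    rcases μ.mem_hexPrism_iff.1 hp with ⟨t, rfl⟩ | rfl | rfl
    · exact hw t
    · simp only; linarith
    · simp only [inner_neg_left]; linarith

/-! ### The in-plane identity and the hexagon's circumradius -/

/-- **Tight-frame identity**: `⟪Lu,w⟫² + ⟪Lv,w⟫² + ⟪L(v−u),w⟫² = 3/2·(‖w‖² − ⟪Le₃,w⟫²)` for a linear isometry `L`. -/
theorem inplane_sq_eq (L : E3 ≃ₗᵢ[ℝ] E3) (w : E3) :
    ⟪L (triangularVec₁ 1), w⟫_ℝ ^ 2 + ⟪L (triangularVec₂ 1), w⟫_ℝ ^ 2 + ⟪L (triangularVec₂ 1 - triangularVec₁ 1), w⟫_ℝ ^ 2 =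
      3 / 2 * (‖w‖ ^ 2 - ⟪L e₃, w⟫_ℝ ^ 2) := by
  have hw : w = L (L.symm w) := (L.apply_symm_apply w).symm
  set w' := L.symm w with hw'
  rw [hw, LinearIsometryEquiv.inner_map_map, LinearIsometryEquiv.inner_map_map, LinearIsometryEquiv.inner_map_map, LinearIsometryEquiv.inner_map_map,
    LinearIsometryEquiv.norm_map, inner_sub_left, inner_u, inner_v, inner_e₃', norm_sq_three']
  have h3 : Real.sqrt 3 ^ 2 = 3 := Real.sq_sqrt (by norm_num)
  nlinarith [h3]

/-- `p² − pq + q² ≤ ¼` on the hexagon `|p|, |q|, |p − q| ≤ ½`. -/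
private theorem sq_sub_mul_add_sq_le {p q : ℝ} (hp : |p| ≤ 1 / 2) (hq : |q| ≤ 1 / 2) (hpq : |p - q| ≤ 1 / 2) : p ^ 2 - p * q + q ^ 2 ≤ 1 / 4 := by
  rw [abs_le] at hp hq hpq
  rcases le_total 0 p with h0p | h0p <;> rcases le_total 0 q with h0q | h0q
  · rcases le_total p q with h | h
      <;> nlinarith
  · nlinarith
  · nlinarith
  · rcases le_total p q with h | h
      <;> nlinarith

/-- **Inside the closed hexagon the in-plane part is at most `1/√3` long**: `‖w‖² − ⟪Le₃,w⟫² ≤ 1/3`. -/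
theorem inplane_sq_le_third_of_hexagon (L : E3 ≃ₗᵢ[ℝ] E3) (w : E3) (h : ∀ t, ⟪L (sixDir t), w⟫_ℝ ≤ 1 / 2) :
    ‖w‖ ^ 2 - ⟪L e₃, w⟫_ℝ ^ 2 ≤ 1 / 3 := by
  have h0 := h 0; have h1 := h 1; have h2 := h 2; have h3' := h 3; have h4 := h 4; have h5 := h 5
  rw [sixDir_zero] at h0
  rw [sixDir_one] at h1
  rw [sixDir_two, map_sub, inner_sub_left] at h2
  rw [sixDir_three, map_neg, inner_neg_left] at h3'
  rw [sixDir_four, map_neg, inner_neg_left] at h4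
  rw [sixDir_five, map_sub, inner_sub_left] at h5
  have hid := inplane_sq_eq L w
  rw [map_sub, inner_sub_left] at hid
  set p := ⟪L (triangularVec₁ 1), w⟫_ℝ with hp
  set q := ⟪L (triangularVec₂ 1), w⟫_ℝ with hq
  have hpa : |p| ≤ 1 / 2 := abs_le.2 ⟨by linarith, h0⟩
  have hqa : |q| ≤ 1 / 2 := abs_le.2 ⟨by linarith, h1⟩
  have hpqa : |p - q| ≤ 1 / 2 := abs_le.2 ⟨by linarith, by linarith⟩
  have key := sq_sub_mul_add_sq_le hpa hqa hpqa
  nlinarith [key, hid]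

/-! ### Governing ranges stay within one spacing of the layer -/

/-- `(m − 1)·hB ≤ govLo r m`. -/
theorem govLo_ge (r : Fin rc.nr) (m : ℤ) : ((m : ℝ) - 1) * hB ≤ μ.govLo r m := by
  have hh := hB_pos
  unfold govLo; split_ifs <;> nlinarith

/-- `govHi r m ≤ (m + 1)·hB`. -/
theorem govHi_le (r : Fin rc.nr) (m : ℤ) : μ.govHi r m ≤ ((m : ℝ) + 1) * hB := by
  have hh := hB_pos
  unfold govHi; split_ifs <;> nlinarith

/-- **A point of the hexagon prism of a site `c` of layer `m` is within distance `< 1` of `c`.** -/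
theorem dist_lt_one_of_mem_hexPrism {r : Fin rc.nr} {c : E3} {m : ℤ} (hc : μ.rheight r c = (m : ℝ) * hB) {y : E3}
    (hy : y ∈ polytope (μ.hexPrism r c m)) : dist y c < 1 := by
  rw [μ.mem_polytope_hexPrism_iff] at hy
  obtain ⟨hw, hlo, hhi⟩ := hy
  set w := y - c with hw_def
  -- in-plane part ≤ 1/3
  have hhex : ∀ t, ⟪μ.rL r (sixDir t), w⟫_ℝ ≤ 1 / 2 := fun t => by
    rw [hw_def, inner_sub_right]; linarith [hw t]
  have hin := inplane_sq_le_third_of_hexagon (μ.rL r) w hhex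
  -- vertical part < hB
  have hvert : ⟪μ.rL r e₃, w⟫_ℝ = μ.rheight r y - μ.rheight r c := by
    rw [hw_def, inner_sub_right, μ.rheight_eq r y, μ.rheight_eq r c, μ.rn_eq r]; ring
  have hlo' := μ.govLo_ge r m
  have hhi' := μ.govHi_le r m
  have hv2 : ⟪μ.rL r e₃, w⟫_ℝ ^ 2 < hB ^ 2 := by
    rw [hvert, hc]
    have h1 : -hB < μ.rheight r y - (m : ℝ) * hB := by linarith
    have h2 : μ.rheight r y - (m : ℝ) * hB < hB := by linarith
    nlinarith
  have hsq : ‖w‖ ^ 2 < 1 := by rw [hB_sq] at hv2; linarith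
  rw [dist_eq_norm, ← hw_def]
  nlinarith [norm_nonneg w]

end Mesh₅

end Summit.Ventures.Crystal3D.Cruxes.TextureLiminf.TexShadow

end
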